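import Summits.Ventures.PercRepro.MSTheoremS

/-!
# Lemma R: the single-trace reduction of Conjecture V

For a family `F` on a finite type and an element `r`, write `proj r F = {t \ {r} : t ∈ F}` for
the projection (trace) along `r`. **Lemma R** (`forall_mem_diffs_of_trace`): if `{r} ∈ F`, every
member containing `r` stays a member after removing `r` (or is `{r}` itself), the projection
`proj r F` is tight, `univ ∉ F` and every element lies in some member, then EVERY member of `F` is
a difference of `F`. Consequently (`diffs_eq_insert_empty_of_trace`) an MS-excess-1 family with
such an `r` has `F \\ F = insert ∅ F` — the block-form conclusion of Conjecture V
(proofs/MINE1-theoremS.md, Addendum 10 §1). The mirror form (`univ \ {r} ∈ F`, members avoiding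
`r` stay members after adding `r`) follows by complementation and is not repeated here.

Proof. A member `t` avoiding `r` is `t \ {r}`; the member `{r}` is `{r} \ s` for any member `s`
avoiding `r`; a member `t = insert r t₁` with `∅ ≠ t₁ ∈ F` and `t ≠ univ` avoids some `x ≠ r`, and
the twin class `q` of `x` for the tight projection `P ∋ ∅` is sandwiched between `∅` and a member
of `P` containing `x`, hence is itself a member of `P` (convexity of tight families on twin-closed
sets, `mem_of_subset_of_subset_of_twinClosed_of_tight`), hence a member of `F` by the hypothesis on
members containing `r`; it is disjoint from `t` (a member of `P` avoiding `x` avoids its class), so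
`t = t \ q`.
-/

namespace PercRepro.MSTight

open Finset
open scoped FinsetFamily

variable {α : Type*} [DecidableEq α] [Fintype α]

omit [Fintype α] in
/-- If `{r} ∈ F` then `∅` lies in the projection along `r`. -/
theorem empty_mem_proj_of_singleton_mem {F : Finset (Finset α)} {r : α}
    (hr : ({r} : Finset α) ∈ F) : (∅ : Finset α) ∈ proj r F :=
  mem_proj.2 ⟨{r}, hr, by simp⟩

/-- In a tight family containing `∅`, the twin class of any element of a member is a member. -/
theorem cls_mem_of_tight_of_empty_mem {P : Finset (Finset α)} (hP : Tight P)
    (h0 : (∅ : Finset α) ∈ P) {s : Finset α} (hs : s ∈ P) {x : α} (hx : x ∈ s) :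
    cls P x ∈ P :=
  mem_of_subset_of_subset_of_twinClosed_of_tight hP h0 hs (Finset.empty_subset _)
    (cls_subset_of_mem hs hx) (twinClosed_cls P x)

/-- **Lemma R (single-trace reduction, block form).** If `{r} ∈ F`, every member containing `r`
is `{r}` or stays a member after erasing `r`, the projection along `r` is tight, `univ ∉ F` and
every element lies in some member, then every member of `F` is a difference of `F`. -/
theorem forall_mem_diffs_of_trace {F : Finset (Finset α)} {r : α}
    (hr : ({r} : Finset α) ∈ F)
    (hrem : ∀ t ∈ F, r ∈ t → t.erase r ∈ F ∨ t = {r})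
    (hP : Tight (proj r F))
    (hU : (Finset.univ : Finset α) ∉ F)
    (hcov : ∀ x : α, ∃ t ∈ F, x ∈ t) :
    ∀ t ∈ F, t ∈ F \\ F := by
  -- some member avoids `r`
  have hF0 : ∃ s ∈ F, r ∉ s := by
    have hx : ∃ x : α, x ≠ r := by
      by_contra h
      apply hU
      have h' : ∀ y : α, y = r := fun y => by
        by_contra hy
        exact h ⟨y, hy⟩
      have huniv : (Finset.univ : Finset α) = {r} := by
        ext y
        simp [h' y]
      rw [huniv]
      exact hr
    obtain ⟨x, hxr⟩ := hx
    obtain ⟨t, htF, hxt⟩ := hcov x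
    by_cases hrt : r ∈ t
    · rcases hrem t htF hrt with h | h
      · exact ⟨t.erase r, h, Finset.notMem_erase r t⟩
      · rw [h] at hxt
        exact absurd (Finset.mem_singleton.1 hxt) hxr
    · exact ⟨t, htF, hrt⟩
  obtain ⟨s₀, hs₀F, hrs₀⟩ := hF0
  have h0P : (∅ : Finset α) ∈ proj r F := empty_mem_proj_of_singleton_mem hr
  intro t htF
  by_cases hrt : r ∈ t
  · rcases hrem t htF hrt with h₁ | h₁
    · -- `t = insert r t₁` with `t₁ = t.erase r ∈ F`
      have htU : t ≠ Finset.univ := fun h => hU (h ▸ htF)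
      obtain ⟨x, hxt⟩ : ∃ x, x ∉ t := by
        by_contra h
        exact htU (Finset.eq_univ_iff_forall.2 fun y => by
          by_contra hy
          exact h ⟨y, hy⟩)
      have hxr : x ≠ r := fun h => hxt (h ▸ hrt)
      obtain ⟨s, hsF, hxs⟩ := hcov x
      have hsP : s.erase r ∈ proj r F := mem_proj.2 ⟨s, hsF, rfl⟩
      have hxs' : x ∈ s.erase r := Finset.mem_erase.2 ⟨hxr, hxs⟩
      -- the twin class of `x` for the projection is a member of the projection
      have hqP : cls (proj r F) x ∈ proj r F := cls_mem_of_tight_of_empty_mem hP h0P hsP hxs'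
      have hxq : x ∈ cls (proj r F) x := self_mem_cls _ x
      have hrq : r ∉ cls (proj r F) x := notMem_of_mem_proj hqP
      -- hence a member of `F`
      have hqF : cls (proj r F) x ∈ F := by
        obtain ⟨s', hs'F, hs'q⟩ := mem_proj.1 hqP
        by_cases hrs' : r ∈ s'
        · rcases hrem s' hs'F hrs' with h | h
          · rwa [hs'q] at h
          · rw [h] at hs'q
            simp at hs'q
            rw [← hs'q] at hxq
            exact absurd hxq (Finset.notMem_empty x)
        · rw [Finset.erase_eq_of_notMem hrs'] at hs'q
          rwa [hs'q] at hs'F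
      -- the class is disjoint from `t`: it avoids `r`, and `t.erase r ∈ proj r F` avoids `x`
      have ht₁P : t.erase r ∈ proj r F := mem_proj.2 ⟨t, htF, rfl⟩
      have hxt₁ : x ∉ t.erase r := fun h => hxt (Finset.mem_of_mem_erase h)
      have hdisj : Disjoint (cls (proj r F) x) (t.erase r) := disjoint_cls_of_notMem ht₁P hxt₁
      have hdisj' : Disjoint t (cls (proj r F) x) := by
        rw [Finset.disjoint_left]
        intro y hyt hyq
        by_cases hyr : y = r
        · exact hrq (hyr ▸ hyq)
        · exact Finset.disjoint_left.1 hdisj hyq (Finset.mem_erase.2 ⟨hyr, hyt⟩)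
      exact mem_diffs.2 ⟨t, htF, cls (proj r F) x, hqF, Finset.sdiff_eq_self_iff_disjoint.2 hdisj'⟩
    · -- `t = {r}`: it is `{r} \ s₀`
      subst h₁
      refine mem_diffs.2 ⟨{r}, htF, s₀, hs₀F, ?_⟩
      rw [Finset.sdiff_eq_self_iff_disjoint, Finset.disjoint_singleton_left]
      exact hrs₀
  · -- `r ∉ t`: `t = t \ {r}`
    refine mem_diffs.2 ⟨t, htF, {r}, hr, ?_⟩
    rw [Finset.sdiff_eq_self_iff_disjoint, Finset.disjoint_singleton_right]
    exact hrt

/-- **Corollary.** An MS-excess-1 family `F` with `∅ ∉ F` and an element `r` as in Lemma R has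
`F \\ F = insert ∅ F` — the block-form conclusion of Conjecture V. -/
theorem diffs_eq_insert_empty_of_trace {F : Finset (Finset α)} {r : α}
    (hr : ({r} : Finset α) ∈ F)
    (hrem : ∀ t ∈ F, r ∈ t → t.erase r ∈ F ∨ t = {r})
    (hP : Tight (proj r F))
    (hU : (Finset.univ : Finset α) ∉ F)
    (hcov : ∀ x : α, ∃ t ∈ F, x ∈ t)
    (hex : (F \\ F).card = F.card + 1)
    (h0 : (∅ : Finset α) ∉ F) :
    F \\ F = insert ∅ F := by
  have hsub : insert ∅ F ⊆ F \\ F := by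
    intro t ht
    rcases Finset.mem_insert.1 ht with rfl | htF
    · exact mem_diffs.2 ⟨{r}, hr, {r}, hr, Finset.sdiff_self _⟩
    · exact forall_mem_diffs_of_trace hr hrem hP hU hcov t htF
  have hcard : (insert ∅ F).card = (F \\ F).card := by
    rw [Finset.card_insert_of_notMem h0, hex]
  exact (Finset.eq_of_subset_of_card_le hsub hcard.ge).symm

end PercRepro.MSTight
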